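import Summits.Langlands.Langlands.Theses.OddResidueBelowFive
import Literature.NumberTheory.GaloisRepresentations.ResidualQuadraticField

/-!
# Line `birth` — BC3 skeleton for the crux `OddResidueBelowFive.TwoAdicDihedral` (stmt-Langlands-18716)

Route `route-Langlands-OddResidueBelowFive` (sub-problem `Langlands`), crux C2 `TwoAdicDihedral` (rank 3):
Fontaine–Mazur / weak automorphy for `ρ : Γ_ℚ → GL₂(ℚ̄₂)` continuous, odd, irreducible, unramified almost
everywhere, de Rham at the place above `2` (pinned Fontaine datum) with multiplicity-free labelled
Hodge–Tate weights, residually absolutely irreducible of DIHEDRAL type.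

## The line: the three cells of the crux, cut by the LOCAL SHAPE AT 2 and by Allen's condition (5)

The crux's own informal text names its cells: "Allen 2014 covers the nearly ordinary case except `ρ̄` induced
from an imaginary quadratic field in which `2` splits: the non-ordinary dihedral cell and the CM-split ordinary
corner".  The skeleton types exactly this partition, in the crux's OWN vocabulary (the local cut
`FramedRep.IsIrreducible (ρ.toLocal v)` at `v ∣ 2` is the one the route already uses to cut C3 at `v ∣ 3`;
Allen's (5) is the accepted `Literature.NumberTheory.GaloisRepresentations.AllenConditionFive`, typed over
`residualQuadraticField ρ̄`, the fixed field of the rotation subgroup of the dihedral projective image):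

* `stub_supersingularCell` — `ρ|Γ_{ℚ₂}` (absolutely) irreducible at the place above `2`: the NON-ORDINARY
  dihedral cell.  OPEN: every printed `2`-adic modularity-lifting theorem off Hida families (Kisin, Invent. Math.
  178 (2009) [2-adic Barsotti–Tate]; Khare–Wintenberger II; Paškūnas 2016; S.-N. Tung, Math. Z. 2021 Thm 1,
  arXiv:1908.06174) assumes NON-SOLVABLE residual image (no `2`-adic Taylor–Wiles primes for dihedral `ρ̄`);
  Paškūnas–Tung arXiv:2104.08948 give the `p = 2` blocks (cokernel killed by `2`) but no patching at `2` is
  written for solvable image.  Size XL.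
* `stub_nearlyOrdinaryAllenCell` — `ρ|Γ_{ℚ₂}` reducible (nearly ordinary) AND Allen's condition (5): the PRINTED
  cell — P. B. Allen, Compositio Math. 150 (2014) 1235–1346 = arXiv:1301.1113, Theorem of the Introduction
  (`F = ℚ`; named fact `Literature.NumberTheory.Automorphic.Allen2014_modularity_nearlyOrdinaryDihedral_Q`,
  accepted p150207), modulo genuine glue: (a) reducible + de Rham with distinct labelled Hodge–Tate weights at `2`
  ⇒ some Tate twist is Skinner–Wiles-ordinary of a weight `k ≥ 2` (the anti-ordinary non-split extension is not
  de Rham: `H¹_g(ℚ₂, ℚ₂(−n)·η) = 0`, `n ≥ 1`; Sen: HT-weight-0 de Rham characters are finite on inertia);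
  (b) `det` of a de Rham character of `Γ_ℚ` is `φ ε₂ⁿ`, `φ` of finite order (Allen's (1)); (c) the dictionary
  "Tate-twist newform ⇒ `L`-algebraic cuspidal `π` Satake–Frobenius compatible a.e." (landed for the twin crux:
  `Summit.Langlands.Langlands.Theorems.DyadicDihedralFM.stub_dictionary`, p145281); (d) dihedral type ⇒ solvable
  image (landed: `…Theorems.DyadicDihedralFM.isSolvable_range_of_isDihedralType`, p150750).  Size L.
* `stub_cmSplitOrdinaryCorner` — `ρ|Γ_{ℚ₂}` reducible AND Allen's (5) FAILS (the residual quadratic field is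
  imaginary and `2` splits in it: Hida's universal nearly ordinary Hecke algebra has CM components, Allen p. 2):
  the CM-SPLIT ORDINARY CORNER.  OPEN except the potentially crystalline consecutive-weight sub-cell (Thorne,
  arXiv:2608.07186 Thm D, named fact `…Thorne2026_fontaineMazurGL2_potCrystallineOrdinary`, p149703).  Size XL.

Composition `TwoAdicDihedral_of` (pure logic, kernel-checked, no `sorry`): case on
`∀ v ∣ 2, FramedRep.IsIrreducible (ρ.toLocal v)` and then on `AllenConditionFive ρ.residualRep`; concludes the
route decl `Summit.Langlands.Langlands.Theses.OddResidueBelowFive.TwoAdicDihedral` BY NAME.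

Honesty (BC3): each stub is the crux restricted to ONE cell (one extra hypothesis, every crux hypothesis kept
verbatim), so no stub is cheaply equivalent to the crux (each misses the other two cells, all three non-empty:
`V₂(X₀(11)) ⊗ ℚ̄₂` is supersingular at `2` with `ρ̄` onto `GL₂(𝔽₂) ≅ D₃`; ordinary newforms with `S₃`-image mod 2
populate the two ordinary cells according to the splitting of `2` in the residual quadratic field) nor to the
summit `Langlands`.  PROBES (planner folder `bc/probe_<stub>.lean`, `lean check` 2026-08-17, one file per stub,
`S` := the stub signature verbatim; every example is expected to error and does):
(a) `S → TwoAdicDihedral` by `first | exact? | simpa [S] | (unfold S; simpa) | aesop` (maxHeartbeats 400000):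
FAIL for 3/3 stubs ("unsolved goals ⊢ TwoAdicDihedral", aesop: "failed to prove the goal after exhaustive search");
(b) `S → Langlands`, same battery: FAIL 3/3; (c1) unfolded + introduced, `exact?`: FAIL 3/3 ("could not close
the goal"); (c2) unfolded + introduced, `aesop`: stub 2 FAIL (exhaustive search), stubs 1, 3 heartbeat TIMEOUT
(not a pass); (c3) `apply h <;> assumption | simp_all`: stub 1 FAIL with the residual goal EXACTLY the cell
hypothesis `∀ v ∋ 2, FramedRep.IsIrreducible (ρ.toLocal v)` (the honest content of the cut), stubs 2, 3 timeout;
(d) `S → Langlands` unfolded (`exact? | aesop | tauto`): FAIL 3/3 (residual goals `Nonempty (ReciprocityData F)`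
and `GlobalLanglandsCorrespondenceGLn n F 𝓡 hcpt` — one cell of clause (B) at `F = ℚ, n = 2, ℓ = 2` says
nothing about them).  No stub drops a crux hypothesis, so no `_false_without_` obstruction of the twin's
`Cruxes/DyadicDihedralFM/Disproof.lean` (cell-selector lemmas; `hirr` redundant) can bite, and no landed
`Theorems/DyadicDihedralFM/Negative/*` lemma refutes an instance of a stub; no Disproof.lean exists for this crux
yet.  Twin crux: `DyadicOddResidue.DyadicDihedralFM` (stmt-Langlands-18742, `IsSolvable ρ.residualRep.range`
typing), PROVED EQUIVALENT to this crux in the tree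
(`…Theorems.DyadicDihedralFM.twoAdicDihedral_iff_dyadicDihedralFM`, p150750); its registered line `Sketch` cuts by
printed theorems (Thorne cell / Allen cell / pro-modular core + Pan II classicality) — this line cuts the same
crux geometrically (local shape at `2` × condition (5)), so the two skeletons are complementary maps of one cell;
the sibling crux C1 `TwoAdicEisenstein` (stmt-Langlands-18715) is cut by the same local predicate in its
`Cruxes/TwoAdicEisenstein/Lines/birth.lean`.
-/

-- `Summit.Langlands.Langlands.…` repeats a namespace component by design (D-0017 nested layout).
set_option linter.dupNamespace false

namespace Summit.Langlands.Langlands.Cruxes.TwoAdicDihedral.Birth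

open Summit.Langlands.Langlands.Theses.OddResidueBelowFive

/-! ## 1. The registered stubs (the ONLY `sorry`s of this file; each the crux on one cell, fully qualified) -/

/-- **Stub 1 — the NON-ORDINARY (supersingular) dihedral cell.**  The crux `TwoAdicDihedral` for those `ρ`
whose restriction to the decomposition group at the place above `2` is irreducible.  OPEN (no printed
`2`-adic modularity lifting theorem allows solvable residual image off Hida families).
[cite: arXiv:1908.06174, Thm 1 (non-solvable image only)] [cite: arXiv:2104.08948, Thms 1.3/1.4]
[cite: doi:10.1007/s00222-009-0207-5] -/
theorem stub_supersingularCell : ∀ (ρ : Literature.NumberTheory.GaloisRepresentations.FramedGaloisRep ℚ (PadicAlgCl 2) 2), ρ.IsOdd → ρ.toGaloisRep.IsIrreducible → (∀ᶠ v : IsDedekindDomain.HeightOneSpectrum (NumberField.RingOfIntegers ℚ) in Filter.cofinite, ρ.IsUnramifiedAt v) → (∀ (v : IsDedekindDomain.HeightOneSpectrum (NumberField.RingOfIntegers ℚ)) (hv : ((2 : ℕ) : NumberField.RingOfIntegers ℚ) ∈ v.asIdeal), (Literature.NumberTheory.PAdicHodge.fontainePstAdicCompletion v 2 hv).IsDeRhamFramed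 (ρ.toLocal v) ∧ ∀ τ : v.adicCompletion ℚ →+* PadicAlgCl 2, Continuous τ → (ρ.labelledHodgeTateWeightsAt v (Literature.NumberTheory.PAdicHodge.fontainePstAdicCompletion v 2 hv).algebra (Literature.NumberTheory.PAdicHodge.fontainePstAdicCompletion v 2 hv).𝔅 τ).Nodup) → ρ.IsResiduallyAbsIrreducible → Literature.NumberTheory.GaloisRepresentations.IsDihedralType ρ.residualRep → (∀ (v : IsDedekindDomain.HeightOneSpectrum (NumberField.RingOfIntegers ℚ)), ((2 : ℕ) : NumberField.RingOfIntegers ℚ) ∈ v.asIdeal → Literature.NumberTheory.GaloisRepresentations.FramedRep.IsIrreducible (ρ.toLocal v)) → ∀ (ι : PadicAlgCl 2 ≃+* ℂ) (hcpt : Literature.NumberTheory.Automorphic.isCompact_glFiniteIntegralLevel 2 ℚ), ∃ π : Literature.NumberTheory.Automorphic.CuspidalAutomorphicRepData 2 ℚ hcpt, π.1.IsLAlgebraic ∧ ∀ᶠ v : IsDedekindDomain.HeightOneSpectrum (NumberField.RingOfIntegers ℚ) in Filter.cofinite, Summit.Langlands.SatakeFrobCompatibleAt ι π.1 ρ v :=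 by
  sorry

/-- **Stub 2 — the NEARLY ORDINARY cell under Allen's condition (5)** (the printed cell).  The crux
`TwoAdicDihedral` for those `ρ` whose restriction to the decomposition group above `2` is REDUCIBLE and whose
residual representation satisfies Allen's (5) (if the residual quadratic field is imaginary, `2` does not split in
it).  IN PRINT modulo glue: Allen 2014, Theorem (`F = ℚ`) — named fact
`Literature.NumberTheory.Automorphic.Allen2014_modularity_nearlyOrdinaryDihedral_Q` — plus (a) reducible + de Rham
with distinct Hodge–Tate weights ⇒ a Tate twist is Skinner–Wiles-ordinary of weight `k ≥ 2`, (b) `det ρ = φ ε₂ⁿ`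
with `φ` finite, (c) the landed dictionary `Theorems.DyadicDihedralFM.stub_dictionary`, (d) dihedral ⇒ solvable
(`Theorems.DyadicDihedralFM.isSolvable_range_of_isDihedralType`).
[cite: arXiv:1301.1113, Theorem of the Introduction, hypotheses (1)–(5)] -/
theorem stub_nearlyOrdinaryAllenCell : ∀ (ρ : Literature.NumberTheory.GaloisRepresentations.FramedGaloisRep ℚ (PadicAlgCl 2) 2), ρ.IsOdd → ρ.toGaloisRep.IsIrreducible → (∀ᶠ v : IsDedekindDomain.HeightOneSpectrum (NumberField.RingOfIntegers ℚ) in Filter.cofinite, ρ.IsUnramifiedAt v) → (∀ (v : IsDedekindDomain.HeightOneSpectrum (NumberField.RingOfIntegers ℚ)) (hv : ((2 : ℕ) : NumberField.RingOfIntegers ℚ) ∈ v.asIdeal), (Literature.NumberTheory.PAdicHodge.fontainePstAdicCompletion v 2 hv).IsDeRhamFramed (ρ.toLocal v) ∧ ∀ τ : v.adicCompletion ℚ →+* PadicAlgCl 2, Continuous τ → (ρ.labelledHodgeTateWeightsAt v (Literature.NumberTheory.PAdicHodge.fontainePstAdicCompletion v 2 hv).algebra (Literature.NumberTheory.PAdicHodge.fontainePstAdicCompletion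 v 2 hv).𝔅 τ).Nodup) → ρ.IsResiduallyAbsIrreducible → Literature.NumberTheory.GaloisRepresentations.IsDihedralType ρ.residualRep → ¬ (∀ (v : IsDedekindDomain.HeightOneSpectrum (NumberField.RingOfIntegers ℚ)), ((2 : ℕ) : NumberField.RingOfIntegers ℚ) ∈ v.asIdeal → Literature.NumberTheory.GaloisRepresentations.FramedRep.IsIrreducible (ρ.toLocal v)) → Literature.NumberTheory.GaloisRepresentations.AllenConditionFive ρ.residualRep → ∀ (ι : PadicAlgCl 2 ≃+* ℂ) (hcpt : Literature.NumberTheory.Automorphic.isCompact_glFiniteIntegralLevel 2 ℚ), ∃ π : Literature.NumberTheory.Automorphic.CuspidalAutomorphicRepData 2 ℚ hcpt, π.1.IsLAlgebraic ∧ ∀ᶠ v : IsDedekindDomain.HeightOneSpectrum (NumberField.RingOfIntegers ℚ) in Filter.cofinite, Summit.Langlands.SatakeFrobCompatibleAt ι π.1 ρ v := by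
  sorry

/-- **Stub 3 — the CM-SPLIT ORDINARY CORNER.**  The crux `TwoAdicDihedral` for those `ρ` whose restriction to
the decomposition group above `2` is REDUCIBLE and whose residual representation VIOLATES Allen's (5): the residual
quadratic field `L` (fixed field of the rotations) is imaginary and `2` splits in `L` — the corner where Hida's
universal nearly ordinary Hecke algebra has CM components (Allen 2014, p. 2).  OPEN except the potentially
crystalline consecutive-weight sub-cell (Thorne 2026, Thm D; named fact
`Literature.NumberTheory.Automorphic.Thorne2026_fontaineMazurGL2_potCrystallineOrdinary`).
[cite: arXiv:1301.1113, Introduction p. 2, hypothesis (5)] [cite: arXiv:2608.07186, Thm D] -/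
theorem stub_cmSplitOrdinaryCorner : ∀ (ρ : Literature.NumberTheory.GaloisRepresentations.FramedGaloisRep ℚ (PadicAlgCl 2) 2), ρ.IsOdd → ρ.toGaloisRep.IsIrreducible → (∀ᶠ v : IsDedekindDomain.HeightOneSpectrum (NumberField.RingOfIntegers ℚ) in Filter.cofinite, ρ.IsUnramifiedAt v) → (∀ (v : IsDedekindDomain.HeightOneSpectrum (NumberField.RingOfIntegers ℚ)) (hv : ((2 : ℕ) : NumberField.RingOfIntegers ℚ) ∈ v.asIdeal), (Literature.NumberTheory.PAdicHodge.fontainePstAdicCompletion v 2 hv).IsDeRhamFramed (ρ.toLocal v) ∧ ∀ τ : v.adicCompletion ℚ →+* PadicAlgCl 2, Continuous τ → (ρ.labelledHodgeTateWeightsAt v (Literature.NumberTheory.PAdicHodge.fontainePstAdicCompletion v 2 hv).algebra (Literature.NumberTheory.PAdicHodge.fontainePstAdicCompletion v 2 hv).𝔅 τ).Nodup) → ρ.IsResiduallyAbsIrreducible → Literature.NumberTheory.GaloisRepresentations.IsDihedralType ρ.residualRep → ¬ (∀ (v : IsDedekindDomain.HeightOneSpectrum (NumberField.RingOfIntegers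 ℚ)), ((2 : ℕ) : NumberField.RingOfIntegers ℚ) ∈ v.asIdeal → Literature.NumberTheory.GaloisRepresentations.FramedRep.IsIrreducible (ρ.toLocal v)) → ¬ Literature.NumberTheory.GaloisRepresentations.AllenConditionFive ρ.residualRep → ∀ (ι : PadicAlgCl 2 ≃+* ℂ) (hcpt : Literature.NumberTheory.Automorphic.isCompact_glFiniteIntegralLevel 2 ℚ), ∃ π : Literature.NumberTheory.Automorphic.CuspidalAutomorphicRepData 2 ℚ hcpt, π.1.IsLAlgebraic ∧ ∀ᶠ v : IsDedekindDomain.HeightOneSpectrum (NumberField.RingOfIntegers ℚ) in Filter.cofinite, Summit.Langlands.SatakeFrobCompatibleAt ι π.1 ρ v := by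
  sorry

/-! ## 2. The stub statements BY NAME (no new content: `type_of%` the registered stubs) -/

namespace _Goal

/-- The statement of `stub_supersingularCell`, as a named `Prop`. [folklore] -/
def stub_supersingularCell : Prop :=
  type_of% @Summit.Langlands.Langlands.Cruxes.TwoAdicDihedral.Birth.stub_supersingularCell

/-- The statement of `stub_nearlyOrdinaryAllenCell`, as a named `Prop`. [folklore] -/
def stub_nearlyOrdinaryAllenCell : Prop :=
  type_of% @Summit.Langlands.Langlands.Cruxes.TwoAdicDihedral.Birth.stub_nearlyOrdinaryAllenCell

/-- The statement of `stub_cmSplitOrdinaryCorner`, as a named `Prop`. [folklore] -/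
def stub_cmSplitOrdinaryCorner : Prop :=
  type_of% @Summit.Langlands.Langlands.Cruxes.TwoAdicDihedral.Birth.stub_cmSplitOrdinaryCorner

end _Goal

/-! ## 3. The composition (kernel-checked, no `sorry`): the three cells exhaust the crux -/

/-- **The crux from its three cells.**  Case on the local shape at the place above `2`
(`∀ v ∣ 2, FramedRep.IsIrreducible (ρ.toLocal v)`, classically decidable) and, in the reducible case, on Allen's
condition (5) for the residual representation; each branch is the corresponding stub verbatim.  Concludes the
route decl `Summit.Langlands.Langlands.Theses.OddResidueBelowFive.TwoAdicDihedral` BY NAME. [folklore] -/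
theorem TwoAdicDihedral_of (h₁ : _Goal.stub_supersingularCell) (h₂ : _Goal.stub_nearlyOrdinaryAllenCell)
    (h₃ : _Goal.stub_cmSplitOrdinaryCorner) : TwoAdicDihedral := by
  intro ρ hodd hirr hur hdR hres hdih ι hcpt
  by_cases hloc : ∀ (v : IsDedekindDomain.HeightOneSpectrum (NumberField.RingOfIntegers ℚ)),
      ((2 : ℕ) : NumberField.RingOfIntegers ℚ) ∈ v.asIdeal →
        Literature.NumberTheory.GaloisRepresentations.FramedRep.IsIrreducible (ρ.toLocal v)
  · exact h₁ ρ hodd hirr hur hdR hres hdih hloc ι hcpt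
  · by_cases h5 : Literature.NumberTheory.GaloisRepresentations.AllenConditionFive ρ.residualRep
    · exact h₂ ρ hodd hirr hur hdR hres hdih hloc h5 ι hcpt
    · exact h₃ ρ hodd hirr hur hdR hres hdih hloc h5 ι hcpt

/-- By-name sanity check (an `example`, not a declaration): the three sorried stubs feed the composition and
close the crux decl. -/
example : TwoAdicDihedral :=
  TwoAdicDihedral_of stub_supersingularCell stub_nearlyOrdinaryAllenCell stub_cmSplitOrdinaryCorner

end Summit.Langlands.Langlands.Cruxes.TwoAdicDihedral.Birth
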